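import Summits.PneNP.PneNP.Theorems.ExpanderLinearGeneratorsGridRoutingClauses

/-!
# PneNP / ExpanderLinearGenerators — a bounded-depth Frege refutation of the grid routing system
yields a proof of the bijective pigeonhole principle (grid routing reduction, assembly)

Route `PneNP/ExpanderLinearGenerators`, support for crux stmt-PneNP-11443. Sixth file of the
Urquhart–Fu / Ben-Sasson reduction: the assembly.

* `gridToOntoPhpS` — from a depth-`d` `textbookFrege` proof `π` of
  `¬ ofCNF (sumEncoding 1 (gridSystem k))`: apply the routing substitution `σ` to `π`
  (`substProofBD`), derive every substituted clause from `¬⋀ontoPHP` (`gridSystemClauseS`),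
  introduce their conjunction and cut — a bounded derivation of
  `¬⋀ontoPHP^{k+2}_{k+1} = ontoPigeonholeForm (k+2) (k+1)`;
* `exists_ontoPhp_proof_of_grid_proof` — packaged: a depth-`(d + 16)` proof of
  `ontoPigeonholeForm (k+2) (k+1)` of size
  `≤ (S (clauseLines k + 52) + 2300) (8 S Z₁ + 3000 (k+3)⁴)`, `S = proofSize π` — polynomial in `k`
  and `S`.

References: A. Urquhart, X. Fu, *Simplified lower bounds for propositional proofs*, NDJFL 37
(1996); E. Ben-Sasson, *Hard examples for the bounded depth Frege proof system*, Comput.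
Complexity 11 (2002), §3; bookkeeping as in `TseitinDepthFregeTransfer.transferS`.
-/

namespace Summit.PneNP.PneNP.Theorems.GridRouting

set_option linter.dupNamespace false -- `Summit.PneNP.PneNP.…`: summit = sub-problem (D-0017)

open Finset Literature.Computability.Complexity.PropForm
open Literature.Computability.Complexity (PropForm Clause CNF Literal eventually_pow_lt_two_rpow_rpow)
open Literature.Computability.MetaComplexity Literature.Computability.MetaComplexity.TextbookFrege
open Literature.Computability.MetaComplexity.KrajicekRamsey (litOf clauseOf ofCNF_eq_conjList
  subst_disjList size_subst_le altDepthAux_subst_le dd_clauseOf_le clauseExtractS dd_neg_ofCNF_le)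

variable {k : ℕ}

/-- **The assembly.** From a depth-`d` `textbookFrege`-proof `π` of the negated rendering of the
grid routing system, a bounded derivation of `¬⋀ontoPHP^{k+2}_{k+1}`: every line of disjunct depth
`≤ d + 15` and size `≤ 8 S Z₁ + 3000 (k+3)⁴`, at most `S (clauseLines k + 52) + 2300` lines
(`S = proofSize π`). [Ben-Sasson 2002, §3; Urquhart–Fu 1996] [folklore] -/
theorem gridToOntoPhpS {d : ℕ} {π : List (PropForm ℕ)}
    (hπ : textbookFrege.IsDepthProofOf d π (neg (PropForm.ofCNF (sumEncoding 1 (gridSystem k))))) :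
    BD (d + 15) (8 * (proofSize π * Z₁ k) + 3000 * (k + 3) ^ 4)
      (proofSize π * (clauseLines k + 52) + 2300) (neg (ontoPhp (k + 1))) := by
  set T := sumEncoding 1 (gridSystem k) with hT
  set S := proofSize π with hS
  set D := d + 15 with hDdef
  set SZ := S * Z₁ k with hSZ
  set B := 8 * SZ + 3000 * (k + 3) ^ 4 with hBdef
  set R' := ontoPhp (k + 1) with hR'
  set Ds := T.map fun c => (clauseOf c).subst (routeSubst k) with hDs
  have hD : 13 ≤ D := by omega
  have hB : 3000 * (k + 3) ^ 4 ≤ B := by omega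
  have hZ1 : 1 ≤ Z₁ k := by simp
  have hS1 : 1 ≤ S := by
    have := size_le_proofSize_of_isDepthProofOf hπ
    have := (neg (PropForm.ofCNF T)).size_pos
    omega
  have hSZ1 : S ≤ SZ := by rw [hSZ]; exact Nat.le_mul_of_pos_right _ hZ1
  have h16 : 16 ≤ (k + 3) ^ 4 :=
    le_trans (by norm_num) (Nat.pow_le_pow_left (show 2 ≤ k + 3 by omega) 4)
  -- depth and size facts
  have hddR' : (neg R').dd ≤ 4 := dd_neg_ontoPhp_le _
  have hszR' : R'.size ≤ 8 * (k + 3) ^ 4 + 1 := by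
    have := size_ontoPhp_le (k + 1)
    rwa [show k + 1 + 2 = k + 3 by omega] at this
  have hddDs : ∀ X ∈ Ds, X.dd ≤ 3 := fun X hX => by
    obtain ⟨c, -, rfl⟩ := List.mem_map.1 hX
    have h1 := altDepthAux_subst_le (altDepthAux_routeSubst_le k) (clauseOf c) 3
    have h2 := dd_clauseOf_le c
    unfold dd at h2 ⊢; omega
  -- (0) the substituted proof
  have h0 := substProofBD (routeSubst k) (size_routeSubst_le k) hZ1 (altDepthAux_routeSubst_le k) hπ
  rw [PropForm.subst, subst_ofCNF_eq_conjList] at h0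
  have hSZ' : proofSize π * (2 * (k + 2) + 1) = SZ := rfl
  have h0' : BD D B S (neg (conjList Ds)) := h0.weaken (by omega) (by rw [hSZ']; omega)
  -- sizes of the substituted clauses
  have hT1 : msum (T.map clauseOf) + 2 ≤ S := by
    have h1 : (neg (PropForm.ofCNF T)).size ≤ S := size_le_proofSize_of_isDepthProofOf hπ
    rw [size, ofCNF_eq_conjList, size_conjList_eq_msum] at h1
    exact h1
  have hmsDs : msum Ds + 2 ≤ SZ := by
    have h2 : msum Ds ≤ msum (T.map clauseOf) * Z₁ k := by
      have e : Ds = (T.map clauseOf).map (PropForm.subst (routeSubst k)) := by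
        rw [hDs, List.map_map]; rfl
      rw [e]
      exact msum_map_subst_le (size_routeSubst_le k) hZ1 _
    have h3 : (msum (T.map clauseOf) + 2) * Z₁ k ≤ S * Z₁ k := Nat.mul_le_mul_right _ hT1
    have h4 : msum (T.map clauseOf) * Z₁ k + 2 ≤ (msum (T.map clauseOf) + 2) * Z₁ k := by
      nlinarith
    omega
  have hlenDs : Ds.length ≤ S := by
    have h1 := length_le_msum (T.map clauseOf)
    rw [List.length_map] at h1
    rw [hDs, List.length_map]
    omega
  -- (1) every substituted clause
  have step1 : ∀ Dj ∈ Ds, BD D B (clauseLines k) (disjList (Dj :: [neg R'])) := by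
    intro Dj hDj
    obtain ⟨c, hc, rfl⟩ := List.mem_map.1 hDj
    exact gridSystemClauseS hD hB hc
  -- (2) `⊢ ⋀ Ds, ¬R'`
  have hctx : ∀ X ∈ Ds ++ [neg R'], X.dd ≤ 5 := by
    intro X hX
    rcases List.mem_append.1 hX with hX | hX
    · exact (hddDs X hX).trans (by omega)
    · simp only [List.mem_cons, List.not_mem_nil, or_false] at hX
      subst hX; omega
  have step2 : BD D B (4 + 50 * (5 + 1) ^ 2 + Ds.length * (clauseLines k + 51))
      (disjList (conjList Ds :: [neg R'])) := by
    refine conjIntroAllS Ds step1 (p := 5) hctx (by omega) (by simp) ?_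
    rw [msum_append]; simp only [msum_cons, msum_nil, size]
    omega
  -- (3) cut against `¬ ⋀ Ds`
  have hddC : (neg (conjList Ds)).dd ≤ 6 := dd_neg_conjList_le hddDs
  have hszC : (conjList Ds).size ≤ SZ := by rw [size_conjList_eq_msum]; omega
  have h3a : BD D B (S + 3) (disjList [neg (conjList Ds)]) :=
    unitS h0' (by omega) (by simp only [size]; omega)
  have h3b : BD D B (S + 3 + 50 * (2 + 1) ^ 2) (disjList (neg (conjList Ds) :: [neg R'])) := by
    refine subsetN (N := 2) h3a (by simp) (p := 6) ?_ (by omega) ?_ (by simp) (by simp)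
    · intro X hX
      simp only [List.mem_cons, List.not_mem_nil, or_false] at hX
      rcases hX with rfl | rfl
      · exact hddC
      · omega
    · simp only [size_disjList_cons, size_disjList_nil, size]; omega
  have h3c := cutS step2 h3b (by simp only [size_disjList_cons, size_disjList_nil, size]; omega)
  have e1 : disjList [neg R'] = disj (neg R') (const false) := rfl
  rw [e1] at h3c
  have h3d := removeBotB h3c (by
      rw [dd_neg, altDepthAux_one_neg]
      have := altDepthAux_le_dd_succ 1 R'
      have : R'.dd ≤ 3 := KrajicekRamsey.dd_ofCNF_le _
      omega) (by simp only [size]; omega)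
  refine h3d.mono ?_
  have : Ds.length * (clauseLines k + 51) ≤ S * (clauseLines k + 51) :=
    Nat.mul_le_mul_right _ hlenDs
  nlinarith

/-- **A refutation of the grid routing system yields a proof of the bijective pigeonhole
principle**: from a depth-`d` `textbookFrege`-proof `π` of `¬ ofCNF (sumEncoding 1 (gridSystem k))`
one obtains a depth-`(d + 16)` proof of `ontoPigeonholeForm (k+2) (k+1)` of size at most
`(S (clauseLines k + 52) + 2300) · (8 S (2k+5) + 3000 (k+3)⁴)`, `S = proofSize π`.
[Urquhart–Fu 1996; Ben-Sasson 2002, §3] [folklore] -/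
theorem exists_ontoPhp_proof_of_grid_proof {d : ℕ} {π : List (PropForm ℕ)}
    (hπ : textbookFrege.IsDepthProofOf d π (neg (PropForm.ofCNF (sumEncoding 1 (gridSystem k))))) :
    ∃ π', textbookFrege.IsDepthProofOf (d + 16) π' (ontoPigeonholeForm (k + 2) (k + 1)) ∧
      proofSize π' ≤ (proofSize π * (clauseLines k + 52) + 2300) *
        (8 * (proofSize π * Z₁ k) + 3000 * (k + 3) ^ 4) := by
  obtain ⟨π', hπ', hsize⟩ := (gridToOntoPhpS hπ).exists_isDepthProofOf
  exact ⟨π', hπ', hsize⟩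

end Summit.PneNP.PneNP.Theorems.GridRouting
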